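import Mathlib
import HarnessLib
import Summits.HubbardSuperconductivity.HubbardSuperconductivity.Theorems.KLProgrammeKLRegimeSplitThermalLayer
import Summits.HubbardSuperconductivity.HubbardSuperconductivity.Theorems.KLProgrammePerturbedFermiCurveCompChainStruct
import Summits.HubbardSuperconductivity.HubbardSuperconductivity.Theorems.KLProgrammeKLRegimeEngineFrameShiftMomentResponseCTSplit
import Summits.HubbardSuperconductivity.HubbardSuperconductivity.Theorems.KLProgrammeKLRegimeEngineFrameShiftDressingSymbols

/-!
# K3 gen-8-FLOW (stmt 20437, stub (C), located item #20, cure (δ′) «LAST-STEP SWAP», layer F3c): INPUTS OF THE RESPONSE BRACKET DISCHARGED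
# FROM REGISTERED CURRENCIES — the frequency window `ω₀ = π/β` vs `4^{n_β}`, the moments of the datum `1`, and the tangential jets of
# `t = (K_N ⊖ K_{n_β})∘γ/ω₀` from the scale-`n_β` flow piece's sup-jets (`FlowPieceJetsAt` shape) and the curve's jets

Cell gate-hubbard-kl, seat p2 g17.  Three of the hypothesis groups of `lastResponse_bracket` (`…EngineLastStepResponseBracket`) in the tree's own words:

* §1 `pi_div_le_Z_div_four_pow_nScales` (`π/β ≤ Z/4^{n_β}` for `β ≥ klBetaMin`, any `Z ≥ 1/32` — `klth_pi_div_le_klScale_nScales`), `beta_div_pi_le_of_nScales_lt`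
  (`β/π ≤ 32·4^N` for `N > n_β` — `klth_klScale_lt_pi_div`): the `hω` input and the price `1/ω₀` of the tangential parameter;
* §2 `moments_datum_one` — `Σ_x (1+|x̃₀|+|x̃₁|)^m·‖𝔉⁻¹[1](x)‖ = 1` (the `hMm_a`/`hMs_a` inputs: the datum of the `−J₂` term is the constant `1`);
* §3 **`lastResponse_tjets_of_pieceJets`** — with `Kn = Ko ⊖ P` (`klFlowFrameU_succ` is `rfl`), sup-jets `‖Dʲ evalM P‖ ≤ G j·uPow j U·4^{(j−2)m}` (`j ≤ 4`, the
  `FlowPieceJetsAt … m` clause verbatim with `G = R.Gfr`), a `C⁴` curve with `‖γ⁽ⁱ⁾(θ)‖ ≤ Dc i`, `N = m+1 > n_β`, `0 < U ≤ 1`, and ONE constant `Z` above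
  `128·G 0`, `128·G 1·Dc 1`, `128·(G 2·Dc 1² + G 1·Dc 2)`, `128·(G 3·Dc 1³ + 3G 2·Dc 1·Dc 2 + G 1·Dc 3)`, `128·(G 4·Dc 1⁴ + 6G 3·Dc 1²·Dc 2 + 3G 2·Dc 2² + 4G 2·Dc 1·Dc 3 + G 1·Dc 4)`:
  `|t(θ)| ≤ Z·U/4^m` and `|t⁽ⁱ⁾(θ)| ≤ (Z·U/4^m)·4^{im}` (`1 ≤ i ≤ 4`) — the `ht0`/`htd` inputs (first order in `U`, ONE scale gain, `lⁱ` per derivative).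

Proofs only; no definitions; nothing asserts superconductivity.  Refs: BGM 2006 §2.4 (2.31a), (2.36)–(2.42) [cite: BenfattoGiulianiMastropietro2006].
-/

noncomputable section

namespace Summit.HubbardSuperconductivity.HubbardSuperconductivity.Theorems.EngineV8

set_option linter.dupNamespace false -- summit = problem name (single-conjunct summit), D-0017

open Real Finset Literature.MathematicalPhysics.QuantumLattice Literature.Probability.LatticeModels
open Summit.HubbardSuperconductivity.HubbardSuperconductivity.Theorems.KLRegimeSplit
open Summit.HubbardSuperconductivity.HubbardSuperconductivity.Theorems.DispersionFlow
open Summit.HubbardSuperconductivity.HubbardSuperconductivity.Theorems.KLProgrammeLegKernels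
open Summit.HubbardSuperconductivity.HubbardSuperconductivity.Theorems.PerturbedFermiCurve

variable {L M : ℕ} [NeZero L]

/-! ## §1 The frequency window -/

omit [NeZero L] in
/-- `π/β ≤ Z/4^{n_β}` for `β ≥ klBetaMin` and any `Z ≥ 1/32` (`Λ_{n_β} = 4^{−n_β}/32 ≥ π/β`). -/
theorem pi_div_le_Z_div_four_pow_nScales {β : ℝ} (hβ : klBetaMin ≤ β) {Z : ℝ} (hZ : 1 / 32 ≤ Z) :
    Real.pi / β ≤ Z / (4 : ℝ) ^ nScales β := by
  have h := klth_pi_div_le_klScale_nScales hβ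
  rw [klScale, klE0] at h
  have h4 : (0 : ℝ) < (4 : ℝ) ^ nScales β := by positivity
  calc Real.pi / β ≤ 1 / 32 * ((4 : ℝ) ^ nScales β)⁻¹ := h
    _ = (1 / 32) / (4 : ℝ) ^ nScales β := by ring
    _ ≤ Z / (4 : ℝ) ^ nScales β := div_le_div_of_nonneg_right hZ h4.le

omit [NeZero L] in
/-- `β/π ≤ 32·4^N` for `N > n_β` (`Λ_N = 4^{−N}/32 < π/β`): the price of `1/ω₀` at the last index. -/
theorem beta_div_pi_le_of_nScales_lt {β : ℝ} (hβ : 0 < β) {N : ℕ} (hN : nScales β < N) :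
    β / Real.pi ≤ 32 * (4 : ℝ) ^ N := by
  have h := klth_klScale_lt_pi_div hβ hN
  rw [klScale, klE0] at h
  have h4 : (0 : ℝ) < (4 : ℝ) ^ N := by positivity
  have hπ := Real.pi_pos
  rw [div_le_iff₀ hπ]
  have h' : 1 / 32 * ((4 : ℝ) ^ N)⁻¹ * β < Real.pi := by
    have := mul_lt_mul_of_pos_right h hβ
    rwa [div_mul_cancel₀ _ hβ.ne'] at this
  have h'' : β < Real.pi * (32 * (4 : ℝ) ^ N) := by
    have := mul_lt_mul_of_pos_right h' (by positivity : (0 : ℝ) < 32 * (4 : ℝ) ^ N)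
    have e : 1 / 32 * ((4 : ℝ) ^ N)⁻¹ * β * (32 * (4 : ℝ) ^ N) = β := by field_simp
    rwa [e] at this
  linarith [mul_comm Real.pi (32 * (4 : ℝ) ^ N)]

/-! ## §2 The moments of the datum `1` -/

/-- `Σ_x (1+|x̃₀|+|x̃₁|)^m·‖𝔉⁻¹[k ↦ 1](x)‖ = 1` for every `m`. -/
theorem moments_datum_one (m : ℕ) :
    ∑ x : TorusSite 2 L, (1 + ((x 0).valMinAbs.natAbs : ℝ) + ((x 1).valMinAbs.natAbs : ℝ)) ^ m *
      ‖torusFourierInv (fun _ : TorusSite 2 L => (((1 : ℝ)) : ℂ)) x‖ = 1 := by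
  rw [sum_weight_norm_torusFourierInv_const]
  simp

/-! ## §3 The tangential jets of `t = (Kn ⊖ Ko)∘γ/ω₀` from the piece's sup-jets and the curve's jets -/

omit [NeZero L] in
/-- `4^{(j−2)m}·(4^m)² = (4^m)ʲ`. -/
theorem four_zpow_sub_two_mul_mul_sq (j m : ℕ) : (4 : ℝ) ^ (((j : ℤ) - 2) * m) * ((4 : ℝ) ^ m) ^ 2 = ((4 : ℝ) ^ m) ^ j := by
  have h4 : ((4 : ℝ) ^ m) ≠ 0 := by positivity
  rw [mul_comm ((j : ℤ) - 2), zpow_mul, zpow_natCast, zpow_sub₀ h4, zpow_natCast, zpow_ofNat, div_mul_cancel₀ _ (pow_ne_zero 2 h4)]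

section Rows

variable {l li U Z : ℝ} (hli1 : li * l ^ 2 = 1) (hl1 : 1 ≤ l) (hU0 : 0 < U) (hU1 : U ≤ 1) (hZ : 0 ≤ Z)
include hli1 hl1 hU0 hU1 hZ

omit hli1 in
/-- The closing step of every row: `128·C ≤ Z` ⇒ `128·(C·lⁿ)·U² ≤ Z·U·lⁿ`. -/
theorem tjetRow_fin {C : ℝ} (n : ℕ) (hC : 128 * C ≤ Z) : 128 * (C * l ^ n) * U ^ 2 ≤ Z * U * l ^ n := by
  have hU2 : U ^ 2 ≤ U := by nlinarith
  have hl0 : 0 ≤ l := by linarith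
  calc 128 * (C * l ^ n) * U ^ 2 = (128 * C) * (U ^ 2 * l ^ n) := by ring
    _ ≤ Z * (U ^ 2 * l ^ n) := mul_le_mul_of_nonneg_right hC (by positivity)
    _ ≤ Z * (U * l ^ n) := mul_le_mul_of_nonneg_left (mul_le_mul_of_nonneg_right hU2 (by positivity)) hZ
    _ = Z * U * l ^ n := by ring

/-- Row `i = 1` of the tangential jets. -/
theorem tjetRow_one {G1 D1 : ℝ} (h : 128 * (G1 * D1) ≤ Z) :
    128 * (G1 * U ^ 2 * l ^ 1 * li * D1) * l ^ 2 ≤ Z * U * l ^ 1 := by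
  have e : 128 * (G1 * U ^ 2 * l ^ 1 * li * D1) * l ^ 2 = 128 * ((G1 * D1) * l ^ 1) * U ^ 2 := by
    linear_combination (128 * (G1 * D1) * l ^ 1 * U ^ 2) * hli1
  rw [e]
  exact tjetRow_fin hl1 hU0 hU1 hZ 1 h

/-- Row `i = 2` of the tangential jets. -/
theorem tjetRow_two {G1 G2 D1 D2 : ℝ} (hG1 : 0 ≤ G1) (hD2 : 0 ≤ D2) (h : 128 * (G2 * D1 ^ 2 + G1 * D2) ≤ Z) :
    128 * (G2 * U ^ 2 * l ^ 2 * li * D1 ^ 2 + G1 * U ^ 2 * l ^ 1 * li * D2) * l ^ 2 ≤ Z * U * l ^ 2 := by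
  have e : 128 * (G2 * U ^ 2 * l ^ 2 * li * D1 ^ 2 + G1 * U ^ 2 * l ^ 1 * li * D2) * l ^ 2 = 128 * (G2 * D1 ^ 2 * l ^ 2 + G1 * D2 * l) * U ^ 2 := by
    linear_combination (128 * (G2 * D1 ^ 2 * l ^ 2 + G1 * D2 * l) * U ^ 2) * hli1
  rw [e]
  have hl2 : l ≤ l ^ 2 := by nlinarith
  have hbr : G2 * D1 ^ 2 * l ^ 2 + G1 * D2 * l ≤ (G2 * D1 ^ 2 + G1 * D2) * l ^ 2 := by
    have a : G1 * D2 * l ≤ G1 * D2 * l ^ 2 := mul_le_mul_of_nonneg_left hl2 (by positivity)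
    linarith
  calc 128 * (G2 * D1 ^ 2 * l ^ 2 + G1 * D2 * l) * U ^ 2 ≤ 128 * ((G2 * D1 ^ 2 + G1 * D2) * l ^ 2) * U ^ 2 :=
        mul_le_mul_of_nonneg_right (mul_le_mul_of_nonneg_left hbr (by norm_num)) (sq_nonneg U)
    _ ≤ Z * U * l ^ 2 := tjetRow_fin hl1 hU0 hU1 hZ 2 h

/-- Row `i = 3` of the tangential jets. -/
theorem tjetRow_three {G1 G2 G3 D1 D2 D3 : ℝ} (hG1 : 0 ≤ G1) (hG2 : 0 ≤ G2) (hD1 : 0 ≤ D1) (hD2 : 0 ≤ D2) (hD3 : 0 ≤ D3)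
    (h : 128 * (G3 * D1 ^ 3 + 3 * G2 * D1 * D2 + G1 * D3) ≤ Z) :
    128 * (G3 * U ^ 2 * l ^ 3 * li * D1 ^ 3 + 3 * (G2 * U ^ 2 * l ^ 2 * li) * D1 * D2 + G1 * U ^ 2 * l ^ 1 * li * D3) * l ^ 2 ≤ Z * U * l ^ 3 := by
  have e : 128 * (G3 * U ^ 2 * l ^ 3 * li * D1 ^ 3 + 3 * (G2 * U ^ 2 * l ^ 2 * li) * D1 * D2 + G1 * U ^ 2 * l ^ 1 * li * D3) * l ^ 2 =
      128 * (G3 * D1 ^ 3 * l ^ 3 + 3 * G2 * D1 * D2 * l ^ 2 + G1 * D3 * l) * U ^ 2 := by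
    linear_combination (128 * (G3 * D1 ^ 3 * l ^ 3 + 3 * G2 * D1 * D2 * l ^ 2 + G1 * D3 * l) * U ^ 2) * hli1
  rw [e]
  have hl2 : l ≤ l ^ 2 := by nlinarith
  have hl3 : l ^ 2 ≤ l ^ 3 := by nlinarith
  have hbr : G3 * D1 ^ 3 * l ^ 3 + 3 * G2 * D1 * D2 * l ^ 2 + G1 * D3 * l ≤ (G3 * D1 ^ 3 + 3 * G2 * D1 * D2 + G1 * D3) * l ^ 3 := by
    have a : 3 * G2 * D1 * D2 * l ^ 2 ≤ 3 * G2 * D1 * D2 * l ^ 3 := mul_le_mul_of_nonneg_left hl3 (by positivity)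
    have b : G1 * D3 * l ≤ G1 * D3 * l ^ 3 := mul_le_mul_of_nonneg_left (hl2.trans hl3) (by positivity)
    linarith
  calc 128 * (G3 * D1 ^ 3 * l ^ 3 + 3 * G2 * D1 * D2 * l ^ 2 + G1 * D3 * l) * U ^ 2
      ≤ 128 * ((G3 * D1 ^ 3 + 3 * G2 * D1 * D2 + G1 * D3) * l ^ 3) * U ^ 2 :=
        mul_le_mul_of_nonneg_right (mul_le_mul_of_nonneg_left hbr (by norm_num)) (sq_nonneg U)
    _ ≤ Z * U * l ^ 3 := tjetRow_fin hl1 hU0 hU1 hZ 3 h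

/-- Row `i = 4` of the tangential jets. -/
theorem tjetRow_four {G1 G2 G3 G4 D1 D2 D3 D4 : ℝ} (hG1 : 0 ≤ G1) (hG2 : 0 ≤ G2) (hG3 : 0 ≤ G3) (hD1 : 0 ≤ D1) (hD2 : 0 ≤ D2)
    (hD3 : 0 ≤ D3) (hD4 : 0 ≤ D4) (h : 128 * (G4 * D1 ^ 4 + 6 * G3 * D1 ^ 2 * D2 + 3 * G2 * D2 ^ 2 + 4 * G2 * D1 * D3 + G1 * D4) ≤ Z) :
    128 * (G4 * U ^ 2 * l ^ 4 * li * D1 ^ 4 + 6 * (G3 * U ^ 2 * l ^ 3 * li) * D1 ^ 2 * D2 + 3 * (G2 * U ^ 2 * l ^ 2 * li) * D2 ^ 2 +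
        4 * (G2 * U ^ 2 * l ^ 2 * li) * D1 * D3 + G1 * U ^ 2 * l ^ 1 * li * D4) * l ^ 2 ≤ Z * U * l ^ 4 := by
  have e : 128 * (G4 * U ^ 2 * l ^ 4 * li * D1 ^ 4 + 6 * (G3 * U ^ 2 * l ^ 3 * li) * D1 ^ 2 * D2 + 3 * (G2 * U ^ 2 * l ^ 2 * li) * D2 ^ 2 +
        4 * (G2 * U ^ 2 * l ^ 2 * li) * D1 * D3 + G1 * U ^ 2 * l ^ 1 * li * D4) * l ^ 2 =
      128 * (G4 * D1 ^ 4 * l ^ 4 + 6 * G3 * D1 ^ 2 * D2 * l ^ 3 + 3 * G2 * D2 ^ 2 * l ^ 2 + 4 * G2 * D1 * D3 * l ^ 2 + G1 * D4 * l) * U ^ 2 := by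
    linear_combination (128 * (G4 * D1 ^ 4 * l ^ 4 + 6 * G3 * D1 ^ 2 * D2 * l ^ 3 + 3 * G2 * D2 ^ 2 * l ^ 2 + 4 * G2 * D1 * D3 * l ^ 2 +
      G1 * D4 * l) * U ^ 2) * hli1
  rw [e]
  have hl2 : l ≤ l ^ 2 := by nlinarith
  have hl3 : l ^ 2 ≤ l ^ 3 := by nlinarith
  have hl4 : l ^ 3 ≤ l ^ 4 := by nlinarith
  have hbr : G4 * D1 ^ 4 * l ^ 4 + 6 * G3 * D1 ^ 2 * D2 * l ^ 3 + 3 * G2 * D2 ^ 2 * l ^ 2 + 4 * G2 * D1 * D3 * l ^ 2 + G1 * D4 * l ≤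
      (G4 * D1 ^ 4 + 6 * G3 * D1 ^ 2 * D2 + 3 * G2 * D2 ^ 2 + 4 * G2 * D1 * D3 + G1 * D4) * l ^ 4 := by
    have a : 6 * G3 * D1 ^ 2 * D2 * l ^ 3 ≤ 6 * G3 * D1 ^ 2 * D2 * l ^ 4 := mul_le_mul_of_nonneg_left hl4 (by positivity)
    have b : 3 * G2 * D2 ^ 2 * l ^ 2 ≤ 3 * G2 * D2 ^ 2 * l ^ 4 := mul_le_mul_of_nonneg_left (hl3.trans hl4) (by positivity)
    have c : 4 * G2 * D1 * D3 * l ^ 2 ≤ 4 * G2 * D1 * D3 * l ^ 4 := mul_le_mul_of_nonneg_left (hl3.trans hl4) (by positivity)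
    have d : G1 * D4 * l ≤ G1 * D4 * l ^ 4 := mul_le_mul_of_nonneg_left (hl2.trans (hl3.trans hl4)) (by positivity)
    linarith
  calc 128 * (G4 * D1 ^ 4 * l ^ 4 + 6 * G3 * D1 ^ 2 * D2 * l ^ 3 + 3 * G2 * D2 ^ 2 * l ^ 2 + 4 * G2 * D1 * D3 * l ^ 2 + G1 * D4 * l) * U ^ 2
      ≤ 128 * ((G4 * D1 ^ 4 + 6 * G3 * D1 ^ 2 * D2 + 3 * G2 * D2 ^ 2 + 4 * G2 * D1 * D3 + G1 * D4) * l ^ 4) * U ^ 2 :=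
        mul_le_mul_of_nonneg_right (mul_le_mul_of_nonneg_left hbr (by norm_num)) (sq_nonneg U)
    _ ≤ Z * U * l ^ 4 := tjetRow_fin hl1 hU0 hU1 hZ 4 h

end Rows

section TJets

variable {β : ℝ} (hβ : 0 < β) {m : ℕ} (hN : nScales β < m + 1) {U : ℝ} (hU0 : 0 < U) (hU1 : U ≤ 1) (Ko P : TrigPolyC4v)
  {G : ℕ → ℝ} (hG0 : ∀ j ≤ 4, 0 ≤ G j)
  (hPJ : ∀ j ≤ 4, ∀ q : Momentum, ‖iteratedFDeriv ℝ j (evalM P) q‖ ≤ G j * uPow j U * (4 : ℝ) ^ (((j : ℤ) - 2) * m))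
  {γ : ℝ → Momentum} (hγ : ContDiff ℝ 4 γ) {Dc : ℕ → ℝ} (hDc : ∀ θ : ℝ, ∀ i, 1 ≤ i → i ≤ 4 → ‖iteratedDeriv i γ θ‖ ≤ Dc i)
  {Z : ℝ} (hZ0 : 128 * G 0 ≤ Z) (hZ1 : 128 * (G 1 * Dc 1) ≤ Z) (hZ2 : 128 * (G 2 * Dc 1 ^ 2 + G 1 * Dc 2) ≤ Z)
  (hZ3 : 128 * (G 3 * Dc 1 ^ 3 + 3 * G 2 * Dc 1 * Dc 2 + G 1 * Dc 3) ≤ Z)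
  (hZ4 : 128 * (G 4 * Dc 1 ^ 4 + 6 * G 3 * Dc 1 ^ 2 * Dc 2 + 3 * G 2 * Dc 2 ^ 2 + 4 * G 2 * Dc 1 * Dc 3 + G 1 * Dc 4) ≤ Z)
include hβ hN hU0 hU1 hG0 hPJ hγ hDc hZ0 hZ1 hZ2 hZ3 hZ4

/-- **THE TANGENTIAL JETS OF `t`.**  `|t(θ)| ≤ Z·U/4^m` and `|t⁽ⁱ⁾(θ)| ≤ (Z·U/4^m)·(4^m)ⁱ` for `1 ≤ i ≤ 4`, every `θ`. -/
theorem lastResponse_tjets_of_pieceJets :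
    (∀ θ : ℝ, |(fun θ' : ℝ => evalM (fsub (fsub Ko P) Ko) (γ θ') / (Real.pi / β)) θ| ≤ Z * U / (4 : ℝ) ^ m) ∧
    (∀ θ : ℝ, ∀ i, 1 ≤ i → i ≤ 4 →
      |iteratedDeriv i (fun θ' : ℝ => evalM (fsub (fsub Ko P) Ko) (γ θ') / (Real.pi / β)) θ| ≤ (Z * U / (4 : ℝ) ^ m) * ((4 : ℝ) ^ m) ^ i) := by
  have hπ := Real.pi_pos
  set l : ℝ := (4 : ℝ) ^ m with hl
  have hl1 : 1 ≤ l := one_le_pow₀ (by norm_num)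
  have hl0 : 0 < l := by positivity
  -- the price of `1/ω₀`: `β/π ≤ 32·4^{m+1} = 128·l`
  have hinv : β / Real.pi ≤ 128 * l := by
    have := beta_div_pi_le_of_nScales_lt hβ hN; rw [pow_succ] at this; linarith
  -- `t = −(β/π)·(evalM P ∘ γ)`
  have ht : (fun θ' : ℝ => evalM (fsub (fsub Ko P) Ko) (γ θ') / (Real.pi / β)) = fun θ' => (-(β / Real.pi)) * (evalM P ∘ γ) θ' := by
    funext θ'; simp only [Function.comp_apply, evalM_fsub]; field_simp; ring
  have hF : ContDiff ℝ 4 (evalM P) := contDiff_evalM P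
  have hcomp : ContDiff ℝ 4 (evalM P ∘ γ) := hF.comp hγ
  -- piece sup-jets in `l`-form
  have hzl : ∀ j : ℕ, (4 : ℝ) ^ (((j : ℤ) - 2) * m) = l ^ j / l ^ 2 := fun j => by
    rw [eq_div_iff (by positivity), hl]; exact four_zpow_sub_two_mul_mul_sq j m
  have hDc0 : ∀ i, 1 ≤ i → i ≤ 4 → 0 ≤ Dc i := fun i h1 h4 => (norm_nonneg _).trans (hDc 0 i h1 h4)
  have hG1 := hG0 1 (by norm_num); have hG2 := hG0 2 (by norm_num); have hG3 := hG0 3 (by norm_num); have hG4 := hG0 4 (by norm_num)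
  have hD1 := hDc0 1 le_rfl (by norm_num); have hD2 := hDc0 2 (by norm_num) (by norm_num)
  have hD3 := hDc0 3 (by norm_num) (by norm_num); have hD4 := hDc0 4 (by norm_num) le_rfl
  have hZ : 0 ≤ Z := le_trans (by positivity) hZ1
  refine ⟨fun θ => ?_, fun θ i hi1 hi4 => ?_⟩
  · -- value: `|t| ≤ (β/π)·G 0·|U|/l² ≤ 128·G 0·U/l`
    rw [ht]
    simp only [Function.comp_apply, abs_mul, abs_neg, abs_of_pos (div_pos hβ hπ)]
    have h0 := hPJ 0 (by norm_num) (γ θ)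
    rw [hzl 0, norm_iteratedFDeriv_zero, Real.norm_eq_abs, pow_zero, uPow_zero, abs_of_pos hU0] at h0
    calc β / Real.pi * |evalM P (γ θ)| ≤ (128 * l) * (G 0 * U * (1 / l ^ 2)) :=
          mul_le_mul hinv h0 (abs_nonneg _) (by positivity)
      _ = (128 * G 0) * U / l := by field_simp
      _ ≤ Z * U / l := by gcongr
  · -- derivatives: Bell with `M j := G j·U²·lʲ·l⁻²`
    have hk' : ((i : ℕ) : WithTop ℕ∞) ≤ 4 := by exact_mod_cast hi4
    rw [ht, iteratedDeriv_const_mul _ (hcomp.contDiffAt.of_le hk'), abs_mul, abs_neg, abs_of_pos (div_pos hβ hπ)]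
    set li : ℝ := (l ^ 2)⁻¹ with hli
    have hli1 : li * l ^ 2 = 1 := inv_mul_cancel₀ (by positivity)
    have hli0 : 0 < li := by positivity
    have hM : ∀ j, 1 ≤ j → j ≤ 4 → ‖iteratedFDeriv ℝ j (evalM P) (γ θ)‖ ≤ G j * U ^ 2 * l ^ j * li := by
      intro j hj1 hj4
      have h := hPJ j hj4 (γ θ)
      have hu : uPow j U = U ^ 2 := by unfold uPow; rw [if_neg (by omega)]
      rw [hzl j, hu, div_eq_mul_inv, ← mul_assoc] at h
      exact h
    obtain ⟨hb1, hb2, hb3, hb4⟩ :=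
      abs_iteratedDeriv_comp_le_bell (F := evalM P) hF hγ (M := fun j => G j * U ^ 2 * l ^ j * li) (D := Dc) hM (hDc θ)
    -- `(β/π)·|X| ≤ (Z U/l)·lⁱ` from `|X| ≤ B` and `128·B·l² ≤ Z·U·lⁱ`
    have goal_of : ∀ {X B : ℝ}, |X| ≤ B → 128 * B * l ^ 2 ≤ Z * U * l ^ i → β / Real.pi * |X| ≤ Z * U / l * l ^ i := by
      intro X B hX hB
      calc β / Real.pi * |X| ≤ (128 * l) * B := mul_le_mul hinv hX (abs_nonneg _) (by positivity)
        _ = (128 * B * l ^ 2) / l := by rw [eq_div_iff hl0.ne']; ring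
        _ ≤ (Z * U * l ^ i) / l := div_le_div_of_nonneg_right hB hl0.le
        _ = Z * U / l * l ^ i := by ring
    interval_cases i
    · exact goal_of hb1 (tjetRow_one hli1 hl1 hU0 hU1 hZ hZ1)
    · exact goal_of hb2 (tjetRow_two hli1 hl1 hU0 hU1 hZ hG1 hD2 hZ2)
    · exact goal_of hb3 (tjetRow_three hli1 hl1 hU0 hU1 hZ hG1 hG2 hD1 hD2 hD3 hZ3)
    · exact goal_of hb4 (tjetRow_four hli1 hl1 hU0 hU1 hZ hG1 hG2 hG3 hD1 hD2 hD3 hD4 hZ4)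

end TJets

end Summit.HubbardSuperconductivity.HubbardSuperconductivity.Theorems.EngineV8

end
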